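import Mathlib
import Summits.KontsevichZagierPeriods.Zeta5Search.Certificates.RecordRayWindow
import Summits.KontsevichZagierPeriods.Zeta5Search.Certificates.RecordRayDenominatorsBricksD16Tail
import HarnessLib

/-!
# (N∃ᶠ) ⊕ (M): infinitely many of Brown–Zudilin's own approximants satisfy `0 < |ζ(5) − p/q| < q^{−γ}`, `γ ≤ 0.8603`
(fam-tele g15 file #8, asked by lead/lit g17 03:47Z)

HONEST FRAMING: systematic search; no irrationality claim unless certified.  ONE by-name theorem combining the
hypothesis-free exponent clause (M) of the record ray (`BrickAtlas.record_exponent_bricksD16_tail`, p3 g7: for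
`0 ≤ γ ≤ 0.8603`, eventually `|ζ(5) − P_n/Q_n| < 1/q_n^γ` with the integers `p_n = MLT·P_n`, `q_n = MLT·|Q_n| ≥ 1`)
with the non-vanishing clause (N∃ᶠ) (`RecordRayWindow.recordPair_frequently_ne_zero`: `Q_n ζ(5) − P_n ≠ 0` for
infinitely many `n`) by `Filter.Frequently.and_eventually`: for infinitely many `n`, BOTH `0 < |ζ(5) − P_n/Q_n|` AND
the printed-type upper bound hold.  `γ < 1`: no irrationality content; how this may be worded relative to
[BrownZudilin2022, Theorem 1] ("infinite sequence", effectivity) is the referees' call, not this file's.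
-/

namespace Summit.KontsevichZagierPeriods.Zeta5Search.RecordRay.Generic

open Filter
open Literature.NumberTheory.Transcendental (zetaValue)
open Summit.KontsevichZagierPeriods.Zeta5Search.RecordRay (recordP recordQ)
open Summit.KontsevichZagierPeriods.Zeta5Search.RecordRay.BrickAtlas (MLT bwinsD16 record_exponent_bricksD16_tail)

/-- **(N∃ᶠ) ⊕ (M) for the record ray.**  For every `0 ≤ γ ≤ 0.8603` and infinitely many `n`, the integers
`p = MLT bwinsD16 n · P_n`, `q = MLT bwinsD16 n · |Q_n| ≥ 1` satisfy `0 < |ζ(5) − P_n/Q_n| < 1/q^γ` (and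
`P_n/Q_n = p/(±q)`).  HONEST FRAMING: `γ < 1`; NOT an irrationality statement. -/
theorem record_thm1_frequently {γ : ℝ} (h0 : 0 ≤ γ) (hγ : γ ≤ 8603 / 10000) :
    ∃ᶠ n : ℕ in atTop, ∃ p : ℤ, ∃ q : ℕ, 1 ≤ q ∧ (q : ℚ) = MLT bwinsD16 n * |(recordQ n : ℚ)| ∧
      (p : ℚ) = MLT bwinsD16 n * recordP n ∧ 0 < |zetaValue 5 - (recordP n : ℝ) / (recordQ n : ℝ)| ∧
        |zetaValue 5 - (recordP n : ℝ) / (recordQ n : ℝ)| < 1 / (q : ℝ) ^ γ := by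
  refine (recordPair_frequently_ne_zero.and_eventually (record_exponent_bricksD16_tail h0 hγ)).mono
    fun n hn => ?_
  obtain ⟨hL, p, q, hq, hqQ, hpP, hlt⟩ := hn
  have hQ : (recordQ n : ℝ) ≠ 0 := by
    intro hQ0
    have hz : recordQ n = 0 := by exact_mod_cast hQ0
    simp [hz] at hqQ
    omega
  refine ⟨p, q, hq, hqQ, hpP, ?_, hlt⟩
  rw [abs_pos, sub_ne_zero]
  intro h
  apply hL
  rw [h]
  field_simp
  ring

end Summit.KontsevichZagierPeriods.Zeta5Search.RecordRay.Generic
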